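import Mathlib
import Summits.ResolutionOfSingularities.ResolutionOfSingularities.Theorems.WeightedInvariantLocalWeightedDropTOT2CurveConflictDivTwo
import Summits.ResolutionOfSingularities.ResolutionOfSingularities.Theorems.WeightedInvariantLocalWeightedDropNCPolyBridgeExit
import Summits.ResolutionOfSingularities.ResolutionOfSingularities.Theorems.WeightedInvariantLocalWeightedDropMonicDescentSliceIdentifyTwo

/-!
# `LocalWeightedDrop`, NC count game — TOT2-LINE piece S-CRV (v1.3 (P3)): a KERNEL EXAMPLE of a conflict born at an on-strategy POINT move
# from a position WITHOUT graph data (the «converse table» of (B3) fails at the `u₂`-chart near answer)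

[OURS · L1 W4.3 · chain w43, engine crux `LocalWeightedDrop` stmt-ResolutionOfSingularities-8899; piece S-CRV / (P3) = res-type-088; `--supports 8899 --as helper`,
counted 0; definition-free; nothing here is a statement of any manuscript; AI-written (gate-accepted = sorry-free with standard axioms, not refereed).]

TOT2-LINE v1.3 (P3) books the conflict budget as `B(A,N) := Σ_{h≠h′}(1+ord(h−h′)) + [u₂ ∈ N]·Σ_h (1+ord h)` over the GRAPH DATA `h` of the label, with
(B3) «non-increasing under succT moves at the near answer … CONVERSE table (no new branches upstairs)».  The converse table fails at the `u₂`-chart: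
for the degree-2 position `A = (u₁(u₂² − u₁)², 0)` (monic form `y² + u₁(u₂² − u₁)²`, every field):
* `A` is a position, neither coordinate curve is permissible and `A` has NO graph datum at all (`not_hasGraphCurveT_pointExample`: its only
  top-locus branch `u₁ = u₂²` is tangent to `V(u₁)`) — so succT plays the POINT move, `A` is not a conflict state, and `B(A,N) = 0` for every `N`;
* the `u₂`-chart near answer is `blowTwoT 2 A = (u₁u₂(u₂ − u₁)², 0)` (`blowTwoT_pointExample`), again a position (same head), which carries the
  transverse graph branch `u₂ = u₁` (datum `h = 1`) — a NEW branch upstairs — and, since the exceptional letter of the `u₂`-chart is `u₂`, is a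
  CONFLICT state for EVERY incoming boundary: **`conflict_blowTwoT_pointExample (N) : NCPoly.Conflict 2 (blowTwoT 2 A) (insert 1 (N.filter (· = 0)))`**
  — even from `N = ∅`.  Hence `B` rises `0 → 1` at an on-strategy near answer; the budget must also charge branches tangent to `V(u₁)` (design note
  `plan/tools/res-type-088/S-CRV-D-DESIGN.md` ADDENDUM v2.1: term `T₁`), cf. the curve-move example `…TOT2CurveConflictBirthExample`.
-/

set_option linter.dupNamespace false -- mandated namespace of this single-conjunct summit

noncomputable section

namespace Summit.ResolutionOfSingularities.ResolutionOfSingularities.Theorems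

namespace TOT2Curve

open MvPowerSeries PolyDescent MonicDescent WildMonic Literature.AlgebraicGeometry.Resolution

variable {k : Type} [Field k]

/-! ## Small computations -/

/-- `u₁² ∤ u₁(u₂² − u₁)²` (the `u₁u₂⁴`-coefficient is `1`). -/
theorem not_X_zero_sq_dvd_pointExample : ¬ (X 0 : MvPowerSeries (Fin 2) k) ^ 2 ∣ X 0 * (X 1 ^ 2 - X 0) ^ 2 := by
  intro h
  have h0 := (X_pow_dvd_iff.mp h) (Finsupp.single 0 1 + Finsupp.single 1 4) (by simp)
  have hsplit : (X 0 * (X 1 ^ 2 - X 0) ^ 2 : MvPowerSeries (Fin 2) k) = X 0 ^ 2 * (X 0 - 2 * X 1 ^ 2) + X 0 ^ 1 * X 1 ^ 4 := by ring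
  have h1 : coeff (Finsupp.single 0 1 + Finsupp.single 1 4) (X 0 ^ 2 * (X 0 - 2 * X 1 ^ 2) : MvPowerSeries (Fin 2) k) = 0 :=
    (X_pow_dvd_iff.mp (dvd_mul_right (X 0 ^ 2) _)) _ (by simp)
  rw [hsplit, map_add, h1, zero_add, X_pow_eq, X_pow_eq, monomial_mul_monomial, one_mul, coeff_monomial_same] at h0
  exact one_ne_zero h0

/-- `u₂² ∤ u₁(u₂² − u₁)²` (the `u₁³`-coefficient is `1`). -/
theorem not_X_one_sq_dvd_pointExample : ¬ (X 1 : MvPowerSeries (Fin 2) k) ^ 2 ∣ X 0 * (X 1 ^ 2 - X 0) ^ 2 := by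
  intro h
  have h0 := (X_pow_dvd_iff.mp h) (Finsupp.single 0 3) (by simp)
  have hsplit : (X 0 * (X 1 ^ 2 - X 0) ^ 2 : MvPowerSeries (Fin 2) k) = X 1 ^ 2 * (X 0 * X 1 ^ 2 - 2 * X 0 ^ 2) + X 0 ^ 3 := by ring
  have h1 : coeff (Finsupp.single 0 3) (X 1 ^ 2 * (X 0 * X 1 ^ 2 - 2 * X 0 ^ 2) : MvPowerSeries (Fin 2) k) = 0 :=
    (X_pow_dvd_iff.mp (dvd_mul_right (X 1 ^ 2) _)) _ (by simp)
  rw [hsplit, map_add, h1, zero_add, X_pow_eq, coeff_monomial_same] at h0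
  exact one_ne_zero h0

/-- `u₁² ∤ u₁u₂(u₂ − u₁)²` (the `u₁u₂³`-coefficient is `1`). -/
theorem not_X_zero_sq_dvd_after : ¬ (X 0 : MvPowerSeries (Fin 2) k) ^ 2 ∣ X 0 * X 1 * (X 1 - X 0) ^ 2 := by
  intro h
  have h0 := (X_pow_dvd_iff.mp h) (Finsupp.single 0 1 + Finsupp.single 1 3) (by simp)
  have hsplit : (X 0 * X 1 * (X 1 - X 0) ^ 2 : MvPowerSeries (Fin 2) k) = X 0 ^ 2 * (X 0 * X 1 - 2 * X 1 ^ 2) + X 0 ^ 1 * X 1 ^ 3 := by ring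
  have h1 : coeff (Finsupp.single 0 1 + Finsupp.single 1 3) (X 0 ^ 2 * (X 0 * X 1 - 2 * X 1 ^ 2) : MvPowerSeries (Fin 2) k) = 0 :=
    (X_pow_dvd_iff.mp (dvd_mul_right (X 0 ^ 2) _)) _ (by simp)
  rw [hsplit, map_add, h1, zero_add, X_pow_eq, X_pow_eq, monomial_mul_monomial, one_mul, coeff_monomial_same] at h0
  exact one_ne_zero h0

/-- `u₂² ∤ u₁u₂(u₂ − u₁)²` (the `u₁³u₂`-coefficient is `1`). -/
theorem not_X_one_sq_dvd_after : ¬ (X 1 : MvPowerSeries (Fin 2) k) ^ 2 ∣ X 0 * X 1 * (X 1 - X 0) ^ 2 := by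
  intro h
  have h0 := (X_pow_dvd_iff.mp h) (Finsupp.single 0 3 + Finsupp.single 1 1) (by simp)
  have hsplit : (X 0 * X 1 * (X 1 - X 0) ^ 2 : MvPowerSeries (Fin 2) k) = X 1 ^ 2 * (X 0 * X 1 - 2 * X 0 ^ 2) + X 0 ^ 3 * X 1 ^ 1 := by ring
  have h1 : coeff (Finsupp.single 0 3 + Finsupp.single 1 1) (X 1 ^ 2 * (X 0 * X 1 - 2 * X 0 ^ 2) : MvPowerSeries (Fin 2) k) = 0 :=
    (X_pow_dvd_iff.mp (dvd_mul_right (X 1 ^ 2) _)) _ (by simp)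
  rw [hsplit, map_add, h1, zero_add, X_pow_eq, X_pow_eq, monomial_mul_monomial, one_mul, coeff_monomial_same] at h0
  exact one_ne_zero h0

/-- The order of `u₁` is `1`. -/
theorem one_le_order_X_zero : (1 : ℕ∞) ≤ (X 0 : MvPowerSeries (Fin 2) k).order := by
  rw [one_le_order_iff_constCoeff_eq_zero, constantCoeff_X]

/-! ## The label before the move -/

/-- `A = (u₁(u₂² − u₁)², 0)` is a position: `ord A₀ ≥ 3 > 2`, `A₁ = 0`. -/
theorem isPosT_pointExample : IsPosT 2 (![X 0 * (X 1 ^ 2 - X 0) ^ 2, 0] : Fin 2 → MvPowerSeries (Fin 2) k) := by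
  intro j
  fin_cases j
  · show ((2 - 0 : ℕ) : ℕ∞) < (X 0 * (X 1 ^ 2 - X 0) ^ 2 : MvPowerSeries (Fin 2) k).order
    have hw : (1 : ℕ∞) ≤ (X 1 ^ 2 - X 0 : MvPowerSeries (Fin 2) k).order := by
      rw [one_le_order_iff_constCoeff_eq_zero, map_sub, map_pow, constantCoeff_X, constantCoeff_X]; ring
    have h2 : (2 : ℕ∞) ≤ ((X 1 ^ 2 - X 0) ^ 2 : MvPowerSeries (Fin 2) k).order := by
      rw [pow_two]
      exact le_trans (by rw [show (2 : ℕ∞) = 1 + 1 by norm_num]; exact add_le_add hw hw) le_order_mul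
    have h3 : (3 : ℕ∞) ≤ (X 0 * (X 1 ^ 2 - X 0) ^ 2 : MvPowerSeries (Fin 2) k).order :=
      le_trans (by rw [show (3 : ℕ∞) = 1 + 2 by norm_num]; exact add_le_add one_le_order_X_zero h2) le_order_mul
    exact lt_of_lt_of_le (by norm_num) h3
  · show ((2 - 1 : ℕ) : ℕ∞) < (0 : MvPowerSeries (Fin 2) k).order
    rw [order_zero]; exact WithTop.coe_lt_top _

/-- `V(y,u₁)` is not permissible for `A`. -/
theorem not_isPermissibleOneT_pointExample : ¬ IsPermissibleOneT 2 (![X 0 * (X 1 ^ 2 - X 0) ^ 2, 0] : Fin 2 → MvPowerSeries (Fin 2) k) := by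
  rw [isPermissibleOneT_iff_X_pow_dvd]
  exact fun h => not_X_zero_sq_dvd_pointExample (h 0)

/-- `V(y,u₂)` is not permissible for `A`. -/
theorem not_isPermissibleTwoT_pointExample : ¬ IsPermissibleTwoT 2 (![X 0 * (X 1 ^ 2 - X 0) ^ 2, 0] : Fin 2 → MvPowerSeries (Fin 2) k) := by
  rw [isPermissibleTwoT_iff_X_pow_dvd]
  exact fun h => not_X_one_sq_dvd_pointExample (h 0)

/-- **`A` HAS NO GRAPH DATUM**: no curve `V(y + ψ, u₂ + u₁h)` is permissible (its only top-locus branch `u₁ = u₂²` is tangent to `V(u₁)`).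
Proof: slot `0` of the sheared re-centred label is `ψ² + u₁((u₂ + u₁h)² − u₁)²`; killing `u₂` gives `φ² = −u₁³(u₁h² − 1)²` for the `u₂`-free
`φ = ψ(u₁,0)` — impossible by the parity of `u₁`-orders. -/
theorem not_hasGraphCurveT_pointExample : ¬ HasGraphCurveT 2 (![X 0 * (X 1 ^ 2 - X 0) ^ 2, 0] : Fin 2 → MvPowerSeries (Fin 2) k) := by
  rintro ⟨h, ψ, hh, -, hperm⟩
  rw [isPermissibleTwoT_iff_X_pow_dvd] at hperm
  have h0 := hperm 0
  -- slot 0 of the re-centred sheared label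
  have hs := hasSubst_of_constantCoeff_zero (constantCoeff_shearFamily (k := k) h)
  have hslot : shift 2 (shearT h (![X 0 * (X 1 ^ 2 - X 0) ^ 2, 0] : Fin 2 → MvPowerSeries (Fin 2) k)) ψ 0 =
      ψ ^ 2 + shear h (X 0 * (X 1 ^ 2 - X 0) ^ 2) := by
    rw [shift_eq, Fin.sum_univ_two]
    have h1 : shearT h (![X 0 * (X 1 ^ 2 - X 0) ^ 2, 0] : Fin 2 → MvPowerSeries (Fin 2) k) 1 = 0 := by
      show shear h 0 = 0
      rw [shear_eq, ← coe_substAlgHom hs, map_zero]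
    have h0' : shearT h (![X 0 * (X 1 ^ 2 - X 0) ^ 2, 0] : Fin 2 → MvPowerSeries (Fin 2) k) 0 = shear h (X 0 * (X 1 ^ 2 - X 0) ^ 2) := rfl
    rw [h1, h0']
    simp
  rw [hslot] at h0
  -- kill `u₂`
  have hshear : shear h (X 0 * (X 1 ^ 2 - X 0) ^ 2 : MvPowerSeries (Fin 2) k) = X 0 * ((X 1 + X 0 * h) ^ 2 - X 0) ^ 2 := by
    rw [shear_eq, ← coe_substAlgHom hs, map_mul, map_pow, map_sub, map_pow, coe_substAlgHom, subst_X hs, subst_X hs]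
    rfl
  have hK0 : subst (![X 0, 0] : Fin 2 → MvPowerSeries (Fin 2) k) (ψ ^ 2 + shear h (X 0 * (X 1 ^ 2 - X 0) ^ 2)) = 0 :=
    (X_one_dvd_iff_killTwo_eq_zero _).mp ((dvd_pow_self (X 1) two_ne_zero).trans h0)
  set φ := subst (![X 0, 0] : Fin 2 → MvPowerSeries (Fin 2) k) ψ with hφ
  have hφ_noY : ∀ e : Fin 2 →₀ ℕ, e 1 ≠ 0 → coeff e φ = 0 := fun e he => by rw [hφ, coeff_subst_killTwo, if_neg he]
  have hKh : subst (![X 0, 0] : Fin 2 → MvPowerSeries (Fin 2) k) h = h := killTwo_of_noY h hh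
  have hkey : φ ^ 2 + X 0 ^ 3 * (X 0 * h ^ 2 - 1) ^ 2 = 0 := by
    have hks := hasSubst_killTwo (k := k)
    rw [hshear, subst_add hks, subst_pow hks, subst_mul hks, subst_pow hks, subst_sub hks, subst_pow hks, subst_add hks, subst_mul hks,
      subst_X hks, subst_X hks, hKh] at hK0
    rw [← hK0]
    simp only [Matrix.cons_val_zero, Matrix.cons_val_one]
    ring
  -- the unit `v = u₁h² − 1`
  have hv : IsUnit (X 0 * h ^ 2 - 1 : MvPowerSeries (Fin 2) k) := by
    rw [isUnit_iff_constantCoeff, map_sub, map_mul, constantCoeff_X, zero_mul, map_one, zero_sub]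
    exact isUnit_one.neg
  obtain ⟨v', hv'⟩ := hv.exists_right_inv
  -- parity of `u₁`-orders
  by_cases hφ0 : φ = 0
  · rw [hφ0, zero_pow two_ne_zero, zero_add] at hkey
    have h1 : (X 0 : MvPowerSeries (Fin 2) k) ^ 3 = 0 := by
      have := congrArg (· * v' ^ 2) hkey
      simpa [mul_assoc, ← mul_pow, hv', zero_mul] using this
    exact pow_ne_zero 3 (X_ne_zero' 0) h1
  obtain ⟨s, u, hu, hφu⟩ := exists_eq_X_pow_mul_unit_of_noY hφ_noY hφ0
  obtain ⟨u', hu'⟩ := hu.exists_right_inv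
  have hrel : (X 0 : MvPowerSeries (Fin 2) k) ^ (2 * s) * u ^ 2 = - (X 0 ^ 3 * (X 0 * h ^ 2 - 1) ^ 2) := by
    have h1 := eq_neg_of_add_eq_zero_left hkey
    rw [hφu] at h1
    rw [← h1]
    ring
  have hu0 : constantCoeff u ≠ 0 := (isUnit_iff_constantCoeff.mp hu).ne_zero
  have hv0 : constantCoeff (X 0 * h ^ 2 - 1 : MvPowerSeries (Fin 2) k) ≠ 0 := (isUnit_iff_constantCoeff.mp hv).ne_zero
  rcases Nat.lt_or_ge (2 * s) 3 with hlt | hge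
  · -- coefficient of `u₁^{2s}`: left `u(0)² ≠ 0`, right `0`
    have hnot : ¬ (Finsupp.single (0 : Fin 2) 3 ≤ Finsupp.single 0 (2 * s)) := fun hle => by
      have := hle 0; simp at this; omega
    have hc := congrArg (coeff (Finsupp.single 0 (2 * s))) hrel
    rw [X_pow_eq, X_pow_eq, coeff_monomial_mul, if_pos le_rfl, tsub_self, one_mul, map_neg, coeff_monomial_mul, if_neg hnot,
      neg_zero, coeff_zero_eq_constantCoeff_apply, map_pow] at hc
    exact pow_ne_zero 2 hu0 hc
  · -- coefficient of `u₁³`: left `0`, right `−v(0)² ≠ 0` (`2s = 3` is impossible)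
    have hgt : 3 < 2 * s := by omega
    have hnot : ¬ (Finsupp.single (0 : Fin 2) (2 * s) ≤ Finsupp.single 0 3) := fun hle => by
      have := hle 0; simp at this; omega
    have hc := congrArg (coeff (Finsupp.single 0 3)) hrel
    rw [X_pow_eq, X_pow_eq, coeff_monomial_mul, if_neg hnot, map_neg, coeff_monomial_mul, if_pos le_rfl, tsub_self, one_mul,
      coeff_zero_eq_constantCoeff_apply, map_pow] at hc
    exact pow_ne_zero 2 hv0 (neg_eq_zero.mp hc.symm)

/-- Hence `A` is not a conflict state for any boundary, and succT plays the POINT move at `A`. -/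
theorem not_conflict_pointExample (N : Finset (Fin 2)) :
    ¬ NCPoly.Conflict 2 (![X 0 * (X 1 ^ 2 - X 0) ^ 2, 0] : Fin 2 → MvPowerSeries (Fin 2) k) N :=
  fun h => not_hasGraphCurveT_pointExample h.2.2.1

/-- The succT-successors of `A` are the point family (origin charts and translated prepared charts). -/
theorem succT_pointExample :
    succT 2 (![X 0 * (X 1 ^ 2 - X 0) ^ 2, 0] : Fin 2 → MvPowerSeries (Fin 2) k) =
      {blowOneT 2 ![X 0 * (X 1 ^ 2 - X 0) ^ 2, 0], blowTwoT 2 ![X 0 * (X 1 ^ 2 - X 0) ^ 2, 0]} ∪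
        {B | ∃ c : k, c ≠ 0 ∧ B = blowOneT 2 (prep 2 (shearT (C c) ![X 0 * (X 1 ^ 2 - X 0) ^ 2, 0]))} :=
  succT_of_point not_isPermissibleOneT_pointExample not_isPermissibleTwoT_pointExample not_hasGraphCurveT_pointExample

/-! ## The `u₂`-chart near answer: a conflict state -/

/-- The `u₂`-chart of the point move: `blowTwoT 2 A = (u₁u₂(u₂ − u₁)², 0)`. -/
theorem blowTwoT_pointExample :
    blowTwoT 2 (![X 0 * (X 1 ^ 2 - X 0) ^ 2, 0] : Fin 2 → MvPowerSeries (Fin 2) k) = ![X 0 * X 1 * (X 1 - X 0) ^ 2, 0] := by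
  funext j
  fin_cases j
  · show blowTwo (2 - 0) (X 0 * (X 1 ^ 2 - X 0) ^ 2 : MvPowerSeries (Fin 2) k) = X 0 * X 1 * (X 1 - X 0) ^ 2
    have hA : ∀ e : Fin 2 →₀ ℕ, coeff e (X 0 * (X 1 ^ 2 - X 0) ^ 2 : MvPowerSeries (Fin 2) k) ≠ 0 → 2 ≤ e 0 + e 1 := by
      intro e he
      have h2 : ((2 - 0 : ℕ) : ℕ∞) < (X 0 * (X 1 ^ 2 - X 0) ^ 2 : MvPowerSeries (Fin 2) k).order := isPosT_pointExample (k := k) 0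
      have hlt : ((2 - 0 : ℕ) : ℕ∞) < ((Finsupp.degree e : ℕ) : ℕ∞) := lt_of_lt_of_le h2 (order_le he)
      have hlt' : (2 - 0 : ℕ) < Finsupp.degree e := by exact_mod_cast hlt
      rw [Finsupp.degree_eq_sum, Fin.sum_univ_two] at hlt'
      omega
    have hs : HasSubst (![X 0 * X 1, X 1] : Fin 2 → MvPowerSeries (Fin 2) k) := hasSubst_of_constantCoeff_zero constantCoeff_blowTwoFamily
    have h := X_pow_mul_blowTwo 2 _ hA
    rw [← coe_substAlgHom hs, map_mul, map_pow, map_sub, map_pow, coe_substAlgHom, subst_X hs, subst_X hs] at h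
    simp only [Matrix.cons_val_zero, Matrix.cons_val_one] at h
    apply mul_left_cancel₀ (pow_ne_zero 2 (X_ne_zero' (1 : Fin 2)))
    rw [Nat.sub_zero, h]
    ring
  · show blowTwo (2 - 1) (0 : MvPowerSeries (Fin 2) k) = 0
    ext e
    rw [coeff_blowTwo]
    split_ifs <;> simp

/-- The near answer is again a position (same order `2`). -/
theorem isPosT_after_pointExample : IsPosT 2 (![X 0 * X 1 * (X 1 - X 0) ^ 2, 0] : Fin 2 → MvPowerSeries (Fin 2) k) := by
  intro j
  fin_cases j
  · show ((2 - 0 : ℕ) : ℕ∞) < (X 0 * X 1 * (X 1 - X 0) ^ 2 : MvPowerSeries (Fin 2) k).order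
    have h1 : (1 : ℕ∞) ≤ (X 1 : MvPowerSeries (Fin 2) k).order := by rw [one_le_order_iff_constCoeff_eq_zero, constantCoeff_X]
    have hw : (1 : ℕ∞) ≤ (X 1 - X 0 : MvPowerSeries (Fin 2) k).order := by
      rw [one_le_order_iff_constCoeff_eq_zero, map_sub, constantCoeff_X, constantCoeff_X, sub_zero]
    have h2 : (2 : ℕ∞) ≤ (X 0 * X 1 : MvPowerSeries (Fin 2) k).order :=
      le_trans (by rw [show (2 : ℕ∞) = 1 + 1 by norm_num]; exact add_le_add one_le_order_X_zero h1) le_order_mul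
    have h2' : (2 : ℕ∞) ≤ ((X 1 - X 0) ^ 2 : MvPowerSeries (Fin 2) k).order := by
      rw [pow_two]
      exact le_trans (by rw [show (2 : ℕ∞) = 1 + 1 by norm_num]; exact add_le_add hw hw) le_order_mul
    have h4 : (4 : ℕ∞) ≤ (X 0 * X 1 * (X 1 - X 0) ^ 2 : MvPowerSeries (Fin 2) k).order :=
      le_trans (by rw [show (4 : ℕ∞) = 2 + 2 by norm_num]; exact add_le_add h2 h2') le_order_mul
    exact lt_of_lt_of_le (by norm_num) h4
  · show ((2 - 1 : ℕ) : ℕ∞) < (0 : MvPowerSeries (Fin 2) k).order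
    rw [order_zero]; exact WithTop.coe_lt_top _

/-- After the move the transverse branch `u₂ = u₁` (datum `h = 1`) is a permissible graph branch — a NEW graph datum upstairs. -/
theorem graphBranch_after_pointExample :
    IsPermissibleTwoT 2 (shift 2 (shearT (1 : MvPowerSeries (Fin 2) k) (![X 0 * X 1 * (X 1 - X 0) ^ 2, 0])) 0) := by
  rw [shift_zero', isPermissibleTwoT_iff_X_pow_dvd]
  have hs := hasSubst_of_constantCoeff_zero (constantCoeff_shearFamily (k := k) 1)
  intro j
  fin_cases j
  · show (X 1 : MvPowerSeries (Fin 2) k) ^ (2 - 0) ∣ shear 1 (X 0 * X 1 * (X 1 - X 0) ^ 2)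
    have h : shear 1 (X 0 * X 1 * (X 1 - X 0) ^ 2 : MvPowerSeries (Fin 2) k) = X 1 ^ 2 * (X 0 * (X 1 + X 0)) := by
      rw [shear_eq, ← coe_substAlgHom hs, map_mul, map_mul, map_pow, map_sub, coe_substAlgHom, subst_X hs, subst_X hs]
      simp only [Matrix.cons_val_zero, Matrix.cons_val_one]
      ring
    rw [h]
    exact dvd_mul_right _ _
  · show (X 1 : MvPowerSeries (Fin 2) k) ^ (2 - 1) ∣ shear 1 0
    rw [shear_eq, ← coe_substAlgHom hs, map_zero]
    exact dvd_zero _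

/-- So the near answer has a graph curve. -/
theorem hasGraphCurveT_after_pointExample : HasGraphCurveT 2 (![X 0 * X 1 * (X 1 - X 0) ^ 2, 0] : Fin 2 → MvPowerSeries (Fin 2) k) :=
  ⟨1, 0, fun e he => by rw [coeff_one, if_neg (fun h0 => he (by rw [h0]; rfl))], map_zero _, graphBranch_after_pointExample⟩

/-- **A CONFLICT BORN AT AN ON-STRATEGY POINT MOVE, FROM A LABEL WITHOUT GRAPH DATA.**  At the `u₂`-chart near answer of succT's point move at
`A = (u₁(u₂² − u₁)², 0)` the successor `blowTwoT 2 A` is a `NCPoly.Conflict` state for the boundary the move produces from ANY incoming boundary `N`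
(`{u₂} ∪ {u₁ : u₁ ∈ N}`, as in `NCPoly.pointMove_of_represents`): the budget of (P3)/(B2) rises from `0` to `1`. -/
theorem conflict_blowTwoT_pointExample (N : Finset (Fin 2)) :
    NCPoly.Conflict 2 (blowTwoT 2 (![X 0 * (X 1 ^ 2 - X 0) ^ 2, 0] : Fin 2 → MvPowerSeries (Fin 2) k))
      (insert 1 (N.filter fun l => l = 0)) := by
  rw [blowTwoT_pointExample]
  refine ⟨?_, ?_, hasGraphCurveT_after_pointExample, Finset.mem_insert_self _ _⟩
  · rw [isPermissibleOneT_iff_X_pow_dvd]; exact fun h => not_X_zero_sq_dvd_after (h 0)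
  · rw [isPermissibleTwoT_iff_X_pow_dvd]; exact fun h => not_X_one_sq_dvd_after (h 0)

/-! ## The label before the move is a REGIME label (well-prepared, position, non-empty Newton set) -/

/-- The coefficients of `u₁(u₂² − u₁)² = u₁u₂⁴ − 2u₁²u₂² + u₁³`. -/
theorem coeff_pointExample (e : Fin 2 →₀ ℕ) :
    coeff e (X 0 * (X 1 ^ 2 - X 0) ^ 2 : MvPowerSeries (Fin 2) k) =
      (if e = Finsupp.single 0 1 + Finsupp.single 1 4 then 1 else 0) +
        (-2) * (if e = Finsupp.single 0 2 + Finsupp.single 1 2 then 1 else 0) + (if e = Finsupp.single 0 3 then 1 else 0) := by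
  have hA : (X 0 * (X 1 ^ 2 - X 0) ^ 2 : MvPowerSeries (Fin 2) k) =
      X 0 ^ 1 * X 1 ^ 4 + C (-2) * (X 0 ^ 2 * X 1 ^ 2) + X 0 ^ 3 := by
    rw [map_neg, map_ofNat]; ring
  rw [hA, map_add, map_add, coeff_C_mul, X_pow_eq, X_pow_eq, X_pow_eq, X_pow_eq, X_pow_eq, monomial_mul_monomial, monomial_mul_monomial,
    one_mul, coeff_monomial, coeff_monomial, coeff_monomial]

/-- The support of `u₁(u₂² − u₁)²`. -/
theorem support_pointExample {e : Fin 2 →₀ ℕ} (he : coeff e (X 0 * (X 1 ^ 2 - X 0) ^ 2 : MvPowerSeries (Fin 2) k) ≠ 0) :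
    e = Finsupp.single 0 1 + Finsupp.single 1 4 ∨ e = Finsupp.single 0 2 + Finsupp.single 1 2 ∨ e = Finsupp.single 0 3 := by
  by_contra hne
  push Not at hne
  apply he
  rw [coeff_pointExample, if_neg hne.1, if_neg hne.2.1, if_neg hne.2.2]
  ring

/-- The scaled Newton set of `A` (degree 2: slot `0` has weight `1`, slot `1` is empty) consists of exponents of `A₀`. -/
theorem mem_newtonSet_pointExample {P : Fin 2 →₀ ℕ}
    (hP : P ∈ newtonSet (![X 0 * (X 1 ^ 2 - X 0) ^ 2, 0] : Fin 2 → MvPowerSeries (Fin 2) k)) :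
    P = Finsupp.single 0 1 + Finsupp.single 1 4 ∨ P = Finsupp.single 0 2 + Finsupp.single 1 2 ∨ P = Finsupp.single 0 3 := by
  rw [WildMonic.mem_newtonSet_iff] at hP
  obtain ⟨⟨j, hj⟩, e, he, hPe⟩ := hP
  rcases j with _ | _ | j
  · change coeff e (X 0 * (X 1 ^ 2 - X 0) ^ 2 : MvPowerSeries (Fin 2) k) ≠ 0 at he
    change P = slotWeight 2 0 • e at hPe
    rw [show slotWeight 2 0 = 1 by decide, one_smul] at hPe
    rw [hPe]
    exact support_pointExample he
  · change coeff e (0 : MvPowerSeries (Fin 2) k) ≠ 0 at he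
    exact absurd (map_zero _) he
  · omega

/-- The two extreme exponents lie in the Newton set (coefficient `1`). -/
theorem mem_newtonSet_pointExample_of_eq {P : Fin 2 →₀ ℕ} (hP : P = Finsupp.single 0 1 + Finsupp.single 1 4 ∨ P = Finsupp.single 0 3) :
    P ∈ newtonSet (![X 0 * (X 1 ^ 2 - X 0) ^ 2, 0] : Fin 2 → MvPowerSeries (Fin 2) k) := by
  rw [WildMonic.mem_newtonSet_iff]
  refine ⟨0, P, ?_, by rw [show slotWeight 2 ↑(0 : Fin 2) = 1 by decide, one_smul]⟩
  show coeff P (X 0 * (X 1 ^ 2 - X 0) ^ 2 : MvPowerSeries (Fin 2) k) ≠ 0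
  have h14 : (Finsupp.single (0 : Fin 2) 1 + Finsupp.single 1 4 : Fin 2 →₀ ℕ) ≠ Finsupp.single 0 2 + Finsupp.single 1 2 := fun h => by
    have := congrArg (fun f : Fin 2 →₀ ℕ => f 1) h; simp at this
  have h14' : (Finsupp.single (0 : Fin 2) 1 + Finsupp.single 1 4 : Fin 2 →₀ ℕ) ≠ Finsupp.single 0 3 := fun h => by
    have := congrArg (fun f : Fin 2 →₀ ℕ => f 1) h; simp at this
  have h30 : (Finsupp.single (0 : Fin 2) 3 : Fin 2 →₀ ℕ) ≠ Finsupp.single 0 1 + Finsupp.single 1 4 := fun h => by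
    have := congrArg (fun f : Fin 2 →₀ ℕ => f 1) h; simp at this
  have h30' : (Finsupp.single (0 : Fin 2) 3 : Fin 2 →₀ ℕ) ≠ Finsupp.single 0 2 + Finsupp.single 1 2 := fun h => by
    have := congrArg (fun f : Fin 2 →₀ ℕ => f 1) h; simp at this
  rcases hP with rfl | rfl
  · rw [coeff_pointExample, if_pos rfl, if_neg h14, if_neg h14']; norm_num
  · rw [coeff_pointExample, if_neg h30, if_neg h30', if_pos rfl]; norm_num

/-- Weights of a two-term exponent. -/
theorem weight_single_add_single (w : Fin 2 → ℕ) (a b : ℕ) :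
    Finsupp.weight w (Finsupp.single 0 a + Finsupp.single 1 b) = a * w 0 + b * w 1 := by
  rw [map_add, Finsupp.weight_apply, Finsupp.weight_apply, Finsupp.sum_single_index (by simp), Finsupp.sum_single_index (by simp),
    smul_eq_mul, smul_eq_mul]

/-- **`A` IS WELL-PREPARED**: its vertices are `(1,4)` and `(3,0)` (not integral for `d = 2`); the middle point `(2,2)` is never a vertex. -/
theorem wellPrepared_pointExample : WellPrepared 2 (![X 0 * (X 1 ^ 2 - X 0) ^ 2, 0] : Fin 2 → MvPowerSeries (Fin 2) k) := by
  intro P hV hS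
  obtain ⟨hP, w, -, hmin⟩ := hV
  obtain ⟨hint, -⟩ := hS
  rcases mem_newtonSet_pointExample hP with rfl | rfl | rfl
  · have h := hint 0
    rw [Nat.factorial_two] at h
    simp at h
  · -- `(2,2)`: compare with `(1,4)` and `(3,0)`
    have h1 := hmin _ (mem_newtonSet_pointExample_of_eq (Or.inl rfl)) (fun h => by
      have := congrArg (fun f : Fin 2 →₀ ℕ => f 1) h; simp at this)
    have h2 := hmin _ (mem_newtonSet_pointExample_of_eq (Or.inr rfl)) (fun h => by
      have := congrArg (fun f : Fin 2 →₀ ℕ => f 1) h; simp at this)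
    rw [weight_single_add_single, weight_single_add_single] at h1
    rw [weight_single_add_single, show (Finsupp.single (0 : Fin 2) 3 : Fin 2 →₀ ℕ) = Finsupp.single 0 3 + Finsupp.single 1 0 by simp,
      weight_single_add_single] at h2
    omega
  · have h := hint 0
    rw [Nat.factorial_two] at h
    simp at h

/-- **`A` IS A REGIME LABEL** (`PolyDescent.InPoly`): well-prepared, a position, non-empty Newton set — so the example of this file happens INSIDE
the regime «e = 2» of the TOT2-LINE, at an on-strategy point move. -/
theorem inPoly_pointExample : InPoly 2 (![X 0 * (X 1 ^ 2 - X 0) ^ 2, 0] : Fin 2 → MvPowerSeries (Fin 2) k) :=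
  ⟨wellPrepared_pointExample, isPosT_pointExample, ⟨_, mem_newtonSet_pointExample_of_eq (Or.inr rfl)⟩⟩

end TOT2Curve

end Summit.ResolutionOfSingularities.ResolutionOfSingularities.Theorems

end
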